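import Summits.QuantumAdvantage.AdviceFreeQNC0.CodegThreeFlats
import Literature.LinearAlgebra.Subspace.GrassmannCliques
import HarnessLib

/-!
# Cell qa-qnc0 (rung F-S1, route RingFrame, crux α, line `tensor`): R1U at co-degree three, part 2b —
# the TOP LAYER: the clique lemma and Chow's star/top dichotomy

Planner qa-qnc0-p2's ROUND-5 §2.3 (THEOREM E3), top layer.  Let `K` be a linear space of order-`≤ 3`
syndromes on `m = d + 4` bits (`Syndrome3.syn3`), each the syndrome of a point set of size `≤ 8`, all with
VANISHING coordinates of order `≤ 2`.  Then (`finrank_top_le`, `d ≥ 1`)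

  `dim K ≤ m − 2`  or  `dim K ≤ 16`.

Proof (ROUND-5 §2 "TOP-LAYER CLIQUE LEMMA" + "star/top", written there for all `e`; here `e = 3`):
* LEADERS ARE 3-FLATS, linearly represented (`CodegThree.exists_linSet_rep`, file `CodegThreeFlats.lean`): every
  non-zero `s ∈ K` is `syn3 𝟙_{V_s}` for a LINEAR point set `V_s` of size `8` (a 3-dimensional subspace `S_s`).
* CLIQUE LEMMA (`card_inter_eq_four`): for linear 3-flats `A ≠ B` and `P` with `𝟙_A + 𝟙_B + 𝟙_P ∈ RM(d, m)`
  (the representatives of `s`, `t`, `s + t`): that word has weight `≤ 22 < 24 = 1.5·16`, so it is `0` (forcing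
  `|A ∩ B| = 4`) or a 4-flat `G` (Kasami–Tokura at `r = d`); `G` then holds more than half of `A` or of `B`,
  hence (`subset_of_lt_two_mul_card_inter`: a flat meeting a linear set in more than half of the latter's points
  contains it and is linear) `A, B ⊆ G`, `dim(A + B) ≤ 4`, i.e. `|A ∩ B| ≥ 4`.  So the direction 3-spaces
  PAIRWISE MEET IN PLANES.
* CHOW (`Literature.LinearAlgebra.Subspace.grassmannClique_star_or_top`, `k = 2`): STAR (common plane `E`;
  `s ↦ S_s/E ∈ 𝔽₂^m/E` is injective, `|K| ≤ 2^{m−2}`) or TOP (all `S_s` inside a space `N` of dimension `≤ 4`;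
  `s ↦ S_s` is injective into the subsets of the `≤ 16` points of `N`, `|K| ≤ 2^{16}`).
The bridge `LinSet`/`toSub` (xor-closed point sets ↔ subspaces of `𝔽₂^m`, `|V₀| = 2^{dim}`) is `CodegThreeFlats.lean`.

The cell's lemmas (planner qa-qnc0-p2 gen 5; seat qa-qnc0-lit gen 11, 2026-08-27).  WHAT THIS IS NOT: no
transversal geometry (the `(d+3)f/4` STAR transversal of ROUND-5 is not formalised — the dimension count suffices
for `K = 7`); nothing on co-degree `≥ 4`, `LiftOneU`, α or the separation.
-/

noncomputable section

namespace Summit.QuantumAdvantage.AdviceFreeQNC0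

open Finset Module
open Literature.Computability.MetaComplexity Literature.Computability.MetaComplexity.Smolensky
open Literature.Computability.QuantumComplexity.BuzetChailloux (bxor zeroVec bxor_comm bxor_self
  bxor_bxor_cancel_left bxor_zeroVec)
open Syndrome2 Syndrome3

namespace CodegThree

open LinSet

variable {n d : ℕ}

/-! ### The clique lemma: linear 3-flat representatives pairwise meet in planes -/

/-- In `𝔽₂`, `x + y = 0 ↔ x = y`. -/
private theorem zmod2_add_eq_zero {x y : ZMod 2} : x + y = 0 ↔ x = y := by
  revert x y; decide

/-- the membership pattern `[u ∈ A] ⊕ [u ∈ B] ⊕ [u ∈ P]`. -/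
private def cf (A B P : Finset (Fin n → Bool)) (u : Fin n → Bool) : Bool :=
  xor (xor (decide (u ∈ A)) (decide (u ∈ B))) (decide (u ∈ P))

/-- the `HasDeg`-indicator of `cf` is `𝟙_A + 𝟙_B + 𝟙_P`. -/
private theorem cf_indicator (A B P : Finset (Fin n → Bool)) :
    (fun u => if cf A B P u then (1 : ZMod 2) else 0) = indF A + indF B + indF P := by
  funext u
  show (if (cf A B P u) = true then (1 : ZMod 2) else 0) = _
  unfold cf
  rw [MeanLoad.ind_xor, MeanLoad.ind_xor]
  simp only [Pi.add_apply, indF, decide_eq_true_eq]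

/-- `cf` is symmetric in `A`, `B`. -/
private theorem cf_comm (A B P : Finset (Fin n → Bool)) : cf A B P = cf B A P := by
  funext u; unfold cf; rw [Bool.xor_comm (decide (u ∈ A))]

/-- One absorption step of the clique lemma: if the flat `S` (a translate of the linear `G₀` through each of
its points, `|S| = 16`) equals the support of `[·∈A] ⊕ [·∈B] ⊕ [·∈P]` and `A ∖ B ∖ P` has `≥ 5` points, then
`A, B ⊆ S = G₀`. -/
private theorem absorb (A B P G₀ : LinSet n) {S : Finset (Fin n → Bool)} (hA : A.pts.card = 8)
    (hB : B.pts.card = 8) (hSmem : ∀ u, u ∈ S ↔ cf A.pts B.pts P.pts u = true)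
    (hS : ∀ z ∈ S, S = G₀.pts.image (bxor z))
    (hsum : ((A.pts \ B.pts) \ P.pts).card + ((B.pts \ A.pts) \ P.pts).card + (A.pts ∩ B.pts).card = 12)
    (h5 : 5 ≤ ((A.pts \ B.pts) \ P.pts).card) :
    A.pts ⊆ S ∧ B.pts ⊆ S ∧ S = G₀.pts := by
  -- `A ∖ B ∖ P ⊆ A ∩ S`
  have h1 : (A.pts \ B.pts) \ P.pts ⊆ A.pts ∩ S := by
    intro u hu
    simp only [Finset.mem_sdiff] at hu
    rw [Finset.mem_inter, hSmem]
    refine ⟨hu.1.1, ?_⟩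
    unfold cf; simp [hu.1.1, hu.1.2, hu.2]
  have hAS : A.pts ⊆ S ∧ S = G₀.pts :=
    A.subset_of_lt_two_mul_card_inter G₀ hS (by have := Finset.card_le_card h1; omega)
  -- then `(A ∩ B) ⊔ (B ∖ A ∖ P) ⊆ B ∩ S`, of size `≥ 5`
  have h2 : (A.pts ∩ B.pts) ∪ ((B.pts \ A.pts) \ P.pts) ⊆ B.pts ∩ S := by
    intro u hu
    rw [Finset.mem_union] at hu
    rw [Finset.mem_inter]
    rcases hu with hu | hu
    · rw [Finset.mem_inter] at hu
      exact ⟨hu.2, hAS.1 hu.1⟩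
    · simp only [Finset.mem_sdiff] at hu
      refine ⟨hu.1.1, ?_⟩
      rw [hSmem]
      unfold cf; simp [hu.1.1, hu.1.2, hu.2]
  have hdisj : Disjoint (A.pts ∩ B.pts) ((B.pts \ A.pts) \ P.pts) := by
    rw [Finset.disjoint_left]
    intro u hu hu'
    rw [Finset.mem_inter] at hu
    simp only [Finset.mem_sdiff] at hu'
    exact hu'.1.2 hu.1
  have hle8 : ((A.pts \ B.pts) \ P.pts).card ≤ (A.pts \ B.pts).card := Finset.card_le_card Finset.sdiff_subset
  have hj1 : 1 ≤ (A.pts ∩ B.pts).card :=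
    Finset.card_pos.2 ⟨zeroVec, Finset.mem_inter.2 ⟨A.zero_mem, B.zero_mem⟩⟩
  have hsd : (A.pts \ B.pts).card + (A.pts ∩ B.pts).card = 8 := by rw [Finset.card_sdiff_add_card_inter, hA]
  have hBS : B.pts ⊆ S ∧ S = G₀.pts := by
    refine B.subset_of_lt_two_mul_card_inter G₀ hS ?_
    have := Finset.card_le_card h2
    rw [Finset.card_union_of_disjoint hdisj] at this
    omega
  exact ⟨hAS.1, hBS.1, hAS.2⟩

/-- **CLIQUE LEMMA** (ROUND-5 §2, top layer, `e = 3`): on `m = d+4` bits, `d ≥ 1`, two DISTINCT linear point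
sets `A, B` of size `8` and a third `P`, with `𝟙_A + 𝟙_B + 𝟙_P ∈ RM(d, m)`, meet in exactly `4` points.
[cite: KasamiTokura1970, Thm 1] -/
theorem card_inter_eq_four (hd : 1 ≤ d) (A B P : LinSet (d + 4)) (hA : A.pts.card = 8) (hB : B.pts.card = 8)
    (hP : P.pts.card = 8) (hAB : A.pts ≠ B.pts)
    (hC : indF A.pts + indF B.pts + indF P.pts ∈ lowDeg (ZMod 2) (d + 4) d) : (A.pts ∩ B.pts).card = 4 := by
  classical
  -- `j = |A ∩ B| = 2^k`, `k ≤ 2`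
  set j := (A.pts ∩ B.pts).card with hj
  have hjpow : j = 2 ^ finrank (ZMod 2) (A.inter B).toSub := (A.inter B).card_eq_two_pow_finrank
  have hj8 : j ≠ 8 := by
    intro h8
    apply hAB
    have h1 : A.pts ∩ B.pts = A.pts := Finset.eq_of_subset_of_card_le Finset.inter_subset_left (by rw [hA]; omega)
    have h2 : A.pts ∩ B.pts = B.pts := Finset.eq_of_subset_of_card_le Finset.inter_subset_right (by rw [hB]; omega)
    rw [← h1, h2]
  have hjle : j ≤ 8 := by rw [hj, ← hA]; exact Finset.card_le_card Finset.inter_subset_left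
  set k := finrank (ZMod 2) (A.inter B).toSub with hk
  have hk3 : k ≤ 3 := by
    by_contra h
    have : 2 ^ 4 ≤ 2 ^ k := Nat.pow_le_pow_right (by norm_num) (by omega)
    omega
  by_cases hk2 : k = 2
  · rw [hjpow, hk2]; norm_num
  exfalso
  have hk1 : k ≤ 1 := by
    rcases Nat.lt_or_ge k 3 with h | h
    · omega
    · have : k = 3 := by omega
      rw [this] at hjpow; norm_num at hjpow; exact (hj8 hjpow).elim
  have hj2 : j ≤ 2 := by
    have : 2 ^ k ≤ 2 ^ 1 := Nat.pow_le_pow_right (by norm_num) hk1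
    omega
  have hj1 : 1 ≤ j := by rw [hjpow]; exact Nat.one_le_two_pow
  -- the support `S` of `[·∈A] ⊕ [·∈B] ⊕ [·∈P]`
  set S := univ.filter (fun u : Fin (d + 4) → Bool => cf A.pts B.pts P.pts u = true) with hSdef
  have hSmem : ∀ u, u ∈ S ↔ cf A.pts B.pts P.pts u = true := fun u => by simp [hSdef]
  have hdeg : HasDeg (cf A.pts B.pts P.pts) d := by
    show (fun u => if cf A.pts B.pts P.pts u then (1 : ZMod 2) else 0) ∈ lowDeg (ZMod 2) (d + 4) d
    rw [cf_indicator]; exact hC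
  -- the symmetric difference `D` of `A` and `B`; `S = D ∆ P`
  set D := (A.pts \ B.pts) ∪ (B.pts \ A.pts) with hD
  have hDdisj : Disjoint (A.pts \ B.pts) (B.pts \ A.pts) := by
    rw [Finset.disjoint_left]; intro u hu hu'
    rw [Finset.mem_sdiff] at hu hu'; exact hu'.2 hu.1
  have hcardD : D.card + 2 * j = 16 := by
    rw [hD, Finset.card_union_of_disjoint hDdisj]
    have h1 := Finset.card_sdiff_add_card_inter A.pts B.pts
    have h2 := Finset.card_sdiff_add_card_inter B.pts A.pts
    rw [Finset.inter_comm B.pts] at h2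
    omega
  have hmemD : ∀ u, u ∈ D ↔ (xor (decide (u ∈ A.pts)) (decide (u ∈ B.pts))) = true := by
    intro u
    rw [hD, Finset.mem_union, Finset.mem_sdiff, Finset.mem_sdiff]
    by_cases ha : u ∈ A.pts <;> by_cases hb : u ∈ B.pts <;> simp [ha, hb]
  have hSeq : S = (D \ P.pts) ∪ (P.pts \ D) := by
    ext u
    rw [hSmem, Finset.mem_union, Finset.mem_sdiff, Finset.mem_sdiff, hmemD]
    unfold cf
    cases (xor (decide (u ∈ A.pts)) (decide (u ∈ B.pts))) <;> by_cases hp : u ∈ P.pts <;> simp [hp]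
  have hSPdisj : Disjoint (D \ P.pts) (P.pts \ D) := by
    rw [Finset.disjoint_left]; intro u hu hu'
    rw [Finset.mem_sdiff] at hu hu'; exact hu.2 hu'.1
  have hcardS : S.card = (D \ P.pts).card + (P.pts \ D).card := by
    rw [hSeq, Finset.card_union_of_disjoint hSPdisj]
  have hDP := Finset.card_sdiff_add_card_inter D P.pts
  have hPD := Finset.card_sdiff_add_card_inter P.pts D
  rw [Finset.inter_comm P.pts] at hPD
  -- `S ≠ ∅` (else `P = D`, `|P| = 16 - 2j ≠ 8`) and `|S| ≤ 22 < 24`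
  have hne : ∃ x, cf A.pts B.pts P.pts x = true := by
    by_contra h
    push Not at h
    have hS0 : S.card = 0 := by
      rw [Finset.card_eq_zero, Finset.eq_empty_iff_forall_notMem]
      intro u hu; exact absurd ((hSmem u).1 hu) (by simp [h u])
    omega
  have hlt : 2 ^ (d + 1) * S.card < 3 * 2 ^ (d + 4) := by
    have hS22 : S.card ≤ 22 := by omega
    have h1 : 2 ^ (d + 1) * S.card ≤ 2 ^ (d + 1) * 22 := Nat.mul_le_mul_left _ hS22
    have h2 : 2 ^ (d + 4) = 2 ^ (d + 1) * 8 := by ring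
    have := Nat.two_pow_pos (d + 1)
    omega
  obtain ⟨hw, h0, hadd, hcard, hcoset⟩ := support_flat_of_lt_three_halves (m := d + 4) hd _ hdeg hne hlt
  have hS16 : S.card = 16 := by
    rw [pow_d4] at hw
    exact Nat.eq_of_mul_eq_mul_left (Nat.two_pow_pos _) hw
  let G₀ : LinSet (d + 4) := ⟨_, h0, hadd⟩
  have hS : ∀ z ∈ S, S = G₀.pts.image (bxor z) := fun z hz => hcoset z ((hSmem z).1 hz)
  -- counting: `|D ∖ P| = 12 - j ≥ 10`, split between `A ∖ B ∖ P` and `B ∖ A ∖ P`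
  have hsplit : ((A.pts \ B.pts) \ P.pts).card + ((B.pts \ A.pts) \ P.pts).card = (D \ P.pts).card := by
    rw [hD, Finset.union_sdiff_distrib, Finset.card_union_of_disjoint]
    exact Finset.disjoint_of_subset_left Finset.sdiff_subset
      (Finset.disjoint_of_subset_right Finset.sdiff_subset hDdisj)
  have hsum : ((A.pts \ B.pts) \ P.pts).card + ((B.pts \ A.pts) \ P.pts).card + (A.pts ∩ B.pts).card = 12 := by
    rw [hsplit, ← hj]; omega
  -- absorb: `A, B ⊆ S = G₀` in either case
  have hABS : A.pts ⊆ S ∧ B.pts ⊆ S ∧ S = G₀.pts := by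
    by_cases h5 : 5 ≤ ((A.pts \ B.pts) \ P.pts).card
    · exact absorb A B P G₀ hA hB hSmem hS hsum h5
    · have h5' : 5 ≤ ((B.pts \ A.pts) \ P.pts).card := by omega
      have hsum' : ((B.pts \ A.pts) \ P.pts).card + ((A.pts \ B.pts) \ P.pts).card + (B.pts ∩ A.pts).card = 12 := by
        rw [Finset.inter_comm]; omega
      have hSmem' : ∀ u, u ∈ S ↔ cf B.pts A.pts P.pts u = true := by
        intro u; rw [hSmem, cf_comm]
      obtain ⟨hB', hA', hSG⟩ := absorb B A P G₀ hB hA hSmem' hS hsum' h5'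
      exact ⟨hA', hB', hSG⟩
  obtain ⟨hAS, hBS, hSG⟩ := hABS
  -- dimensions: `dim(A ⊔ B) = 6 - k ≥ 5` inside the 4-space `G₀`
  have hG4 : finrank (ZMod 2) G₀.toSub = 4 := finrank_eq_of_card (by rw [← hSG, hS16]; norm_num)
  have hAle : A.toSub ≤ G₀.toSub := (toSub_le_iff A G₀).2 (hSG ▸ hAS)
  have hBle : B.toSub ≤ G₀.toSub := (toSub_le_iff B G₀).2 (hSG ▸ hBS)
  haveI : FiniteDimensional (ZMod 2) A.toSub := Module.finite_of_finrank_eq_succ (finrank_eq_of_card (k := 3) hA)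
  haveI : FiniteDimensional (ZMod 2) B.toSub := Module.finite_of_finrank_eq_succ (finrank_eq_of_card (k := 3) hB)
  haveI : FiniteDimensional (ZMod 2) G₀.toSub := Module.finite_of_finrank_eq_succ hG4
  have hsup := Submodule.finrank_sup_add_finrank_inf_eq A.toSub B.toSub
  rw [finrank_eq_of_card (k := 3) hA, finrank_eq_of_card (k := 3) hB, ← toSub_inter, ← hk] at hsup
  have hle4 : finrank (ZMod 2) ↥(A.toSub ⊔ B.toSub) ≤ 4 := by
    have h := Submodule.finrank_mono (sup_le hAle hBle)
    rw [hG4] at h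
    exact h
  omega

/-! ### The top layer: Chow's star/top dichotomy, by counting -/

/-- **TOP LAYER BOUND** (ROUND-5 §2.3): on `m = d + 4` bits (`d ≥ 1`), a linear space `K` of order-`≤ 3`
syndromes, each the syndrome of `≤ 8` points and all with vanishing coordinates of order `≤ 2`, has
`dim K ≤ m − 2` (STAR) or `dim K ≤ 16` (TOP). [cite: Pankov2014, §3.2 Prop 3.3] -/
theorem finrank_top_le (hd : 1 ≤ d) (K : Submodule (ZMod 2) (Finset (Fin (d + 4)) → ZMod 2))
    (hK : ∀ s ∈ K, ∃ a : Finset (Fin (d + 4) → Bool), a.card ≤ 8 ∧ syn3 (indF a) = s)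
    (hlow : ∀ s ∈ K, ∀ J : Finset (Fin (d + 4)), J.card ≤ 2 → s J = 0) :
    finrank (ZMod 2) K ≤ d + 2 ∨ finrank (ZMod 2) K ≤ 16 := by
  classical
  -- linear representatives of the non-zero elements
  have hrep : ∀ s : {s : K // (s : Finset (Fin (d + 4)) → ZMod 2) ≠ 0},
      ∃ V : LinSet (d + 4), V.pts.card = 8 ∧ syn3 (indF V.pts) = (s.1 : Finset (Fin (d + 4)) → ZMod 2) := by
    intro s
    obtain ⟨a, ha8, has⟩ := hK s.1 s.1.2
    exact exists_linSet_rep s.2 ha8 has (hlow s.1 s.1.2)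
  choose V hV8 hVs using hrep
  -- `|K| = 2^{dim K}`
  have hcardK : Nat.card K = 2 ^ finrank (ZMod 2) K := by
    rw [Module.natCard_eq_pow_finrank (K := ZMod 2) (V := K), Nat.card_eq_fintype_card (α := ZMod 2), ZMod.card]
  -- distinct non-zero elements have distinct representatives
  have hVinj : ∀ s t, (V s).pts = (V t).pts → s = t := by
    intro s t h
    apply Subtype.ext; apply Subtype.ext
    rw [← hVs s, ← hVs t, h]
  -- the family of direction 3-spaces and the clique property
  have h3 : ∀ s, finrank (ZMod 2) (V s).toSub = 3 := fun s => finrank_eq_of_card (hV8 s)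
  have hadj : ∀ s t, (V s).toSub ≠ (V t).toSub → finrank (ZMod 2) ↥((V s).toSub ⊓ (V t).toSub) = 2 := by
    intro s t hne
    have hpts : (V s).pts ≠ (V t).pts := fun h => hne (by rw [LinSet.ext' h])
    have hst : (s.1 : Finset (Fin (d + 4)) → ZMod 2) + t.1 ≠ 0 := by
      intro h
      apply hpts
      have : s = t := by
        apply Subtype.ext; apply Subtype.ext
        funext J
        exact zmod2_add_eq_zero.1 (congrFun h J)
      rw [this]
    let u : {s : K // (s : Finset (Fin (d + 4)) → ZMod 2) ≠ 0} := ⟨s.1 + t.1, by simpa using hst⟩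
    have hC : indF (V s).pts + indF (V t).pts + indF (V u).pts ∈ lowDeg (ZMod 2) (d + 4) d := by
      rw [← ker_syn3_eq_lowDeg, LinearMap.mem_ker, map_add, map_add, hVs, hVs, hVs]
      show (s.1 : Finset (Fin (d + 4)) → ZMod 2) + t.1 + (s.1 + t.1) = 0
      exact CharTwo.add_self_eq_zero _
    have h4 := card_inter_eq_four hd (V s) (V t) (V u) (hV8 s) (hV8 t) (hV8 u) hpts hC
    rw [← toSub_inter]
    exact finrank_eq_of_card (k := 2) (by rw [inter_pts, h4]; norm_num)
  rcases Literature.LinearAlgebra.Subspace.grassmannClique_star_or_top (k := 2) (fun s => (V s).toSub) h3 hadj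
    with ⟨E, hEfin, hE2, hEle⟩ | ⟨N, hNfin, hN4, hNle⟩
  · -- STAR: inject `K` into `𝔽₂^m / E`
    left
    haveI := hEfin
    have hpick : ∀ s, ∃ v ∈ (V s).pts, bvec v ∉ E := by
      intro s
      have hlt : E < (V s).toSub := by
        refine lt_of_le_of_ne (hEle s) fun h => ?_
        have := h3 s; rw [← h, hE2] at this; exact absurd this (by norm_num)
      obtain ⟨x, hx, hxE⟩ := SetLike.exists_of_lt hlt
      obtain ⟨v, hv, rfl⟩ := (V s).exists_of_mem_toSub hx
      exact ⟨v, hv, hxE⟩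
    choose w hw hwE using hpick
    let ψ : K → (Fin (d + 4) → ZMod 2) ⧸ E := fun s =>
      if h : (s : Finset (Fin (d + 4)) → ZMod 2) = 0 then 0 else Submodule.Quotient.mk (bvec (w ⟨s, h⟩))
    have hψ : Function.Injective ψ := by
      intro s t hst
      by_cases hs : (s : Finset (Fin (d + 4)) → ZMod 2) = 0 <;> by_cases ht : (t : Finset (Fin (d + 4)) → ZMod 2) = 0
      · exact Subtype.ext (hs.trans ht.symm)
      · exfalso
        simp only [ψ, dif_pos hs, dif_neg ht] at hst
        exact hwE ⟨t, ht⟩ ((Submodule.Quotient.mk_eq_zero E).1 hst.symm)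
      · exfalso
        simp only [ψ, dif_neg hs, dif_pos ht] at hst
        exact hwE ⟨s, hs⟩ ((Submodule.Quotient.mk_eq_zero E).1 hst)
      · simp only [ψ, dif_neg hs, dif_neg ht] at hst
        have hdiff : bvec (w ⟨s, hs⟩) - bvec (w ⟨t, ht⟩) ∈ E := (Submodule.Quotient.eq E).1 hst
        by_contra hne
        have hne' : (⟨s, hs⟩ : {s : K // (s : Finset (Fin (d + 4)) → ZMod 2) ≠ 0}) ≠ ⟨t, ht⟩ :=
          fun h => hne (congrArg Subtype.val h)
        have hsub : (V ⟨s, hs⟩).toSub ≠ (V ⟨t, ht⟩).toSub := fun h => hne' (hVinj _ _ (pts_eq_of_toSub_eq h))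
        -- `bvec w_s ∈ V_s ⊓ V_t = E`: contradiction
        have hxt : bvec (w ⟨s, hs⟩) ∈ (V ⟨t, ht⟩).toSub := by
          have h1 : bvec (w ⟨t, ht⟩) ∈ (V ⟨t, ht⟩).toSub := (V ⟨t, ht⟩).bvec_mem_toSub.2 (hw _)
          have h2 := Submodule.add_mem _ (hEle ⟨t, ht⟩ hdiff) h1
          rwa [sub_add_cancel] at h2
        have hxs : bvec (w ⟨s, hs⟩) ∈ (V ⟨s, hs⟩).toSub := (V ⟨s, hs⟩).bvec_mem_toSub.2 (hw _)
        haveI : FiniteDimensional (ZMod 2) ↥((V ⟨s, hs⟩).toSub ⊓ (V ⟨t, ht⟩).toSub) := by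
          haveI : FiniteDimensional (ZMod 2) (V ⟨s, hs⟩).toSub := Module.finite_of_finrank_eq_succ (h3 _)
          exact Submodule.finiteDimensional_inf_left _ _
        have hEeq : E = (V ⟨s, hs⟩).toSub ⊓ (V ⟨t, ht⟩).toSub :=
          Submodule.eq_of_le_of_finrank_eq (le_inf (hEle _) (hEle _)) (by rw [hE2, hadj _ _ hsub])
        exact hwE ⟨s, hs⟩ (hEeq ▸ Submodule.mem_inf.2 ⟨hxs, hxt⟩)
    have hQ : finrank (ZMod 2) ((Fin (d + 4) → ZMod 2) ⧸ E) = d + 2 := by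
      have h := Submodule.finrank_quotient_add_finrank E
      rw [hE2, Module.finrank_fintype_fun_eq_card, Fintype.card_fin] at h
      omega
    have hcardQ : Nat.card ((Fin (d + 4) → ZMod 2) ⧸ E) = 2 ^ (d + 2) := by
      rw [Module.natCard_eq_pow_finrank (K := ZMod 2) (V := (Fin (d + 4) → ZMod 2) ⧸ E),
        Nat.card_eq_fintype_card (α := ZMod 2), ZMod.card, hQ]
    have hle := Nat.card_le_card_of_injective ψ hψ
    rw [hcardK, hcardQ] at hle
    exact (Nat.pow_le_pow_iff_right (le_refl 2)).1 hle
  · -- TOP: inject `K` into the subsets of the points of `N`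
    right
    haveI := hNfin
    set Npts := univ.filter (fun v : Fin (d + 4) → Bool => bvec v ∈ N) with hNpts
    have hNcard : Npts.card ≤ 16 := by
      have hN : Nat.card N = 2 ^ finrank (ZMod 2) N := by
        rw [Module.natCard_eq_pow_finrank (K := ZMod 2) (V := N), Nat.card_eq_fintype_card (α := ZMod 2), ZMod.card]
      have hinj : Function.Injective (fun v : Npts => (⟨bvec v.1, (Finset.mem_filter.1 v.2).2⟩ : N)) := by
        intro v v' h
        exact Subtype.ext (bvec_injective (congrArg Subtype.val h))
      have hle := Nat.card_le_card_of_injective _ hinj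
      rw [Nat.card_eq_fintype_card, Fintype.card_coe, hN] at hle
      calc Npts.card ≤ 2 ^ finrank (ZMod 2) N := hle
        _ ≤ 2 ^ 4 := Nat.pow_le_pow_right (by norm_num) hN4
        _ = 16 := by norm_num
    let ψ : K → Npts.powerset := fun s =>
      if h : (s : Finset (Fin (d + 4)) → ZMod 2) = 0 then ⟨∅, Finset.mem_powerset.2 (Finset.empty_subset _)⟩
      else ⟨(V ⟨s, h⟩).pts, Finset.mem_powerset.2 fun v hv =>
        Finset.mem_filter.2 ⟨Finset.mem_univ _, hNle ⟨s, h⟩ ((V ⟨s, h⟩).bvec_mem_toSub.2 hv)⟩⟩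
    have hψ : Function.Injective ψ := by
      intro s t hst
      by_cases hs : (s : Finset (Fin (d + 4)) → ZMod 2) = 0 <;> by_cases ht : (t : Finset (Fin (d + 4)) → ZMod 2) = 0
      · exact Subtype.ext (hs.trans ht.symm)
      · exfalso
        simp only [ψ, dif_pos hs, dif_neg ht, Subtype.mk.injEq] at hst
        have := hV8 ⟨t, ht⟩; rw [← hst, Finset.card_empty] at this; exact absurd this (by norm_num)
      · exfalso
        simp only [ψ, dif_neg hs, dif_pos ht, Subtype.mk.injEq] at hst
        have := hV8 ⟨s, hs⟩; rw [hst, Finset.card_empty] at this; exact absurd this (by norm_num)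
      · simp only [ψ, dif_neg hs, dif_neg ht, Subtype.mk.injEq] at hst
        exact congrArg Subtype.val (hVinj _ _ hst)
    have hle := Nat.card_le_card_of_injective ψ hψ
    rw [hcardK, Nat.card_eq_fintype_card, Fintype.card_coe, Finset.card_powerset] at hle
    exact ((Nat.pow_le_pow_iff_right (le_refl 2)).1 hle).trans hNcard

end CodegThree

end Summit.QuantumAdvantage.AdviceFreeQNC0

end
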